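import Summits.QuantumFields.YangMills.Theorems.BalabanUVNodesN08HaarCompatibilityGuardCrossingLaw

/-!
# BalabanUVNodes ∕ N08 — THE TYPED «T1 = 1» LETTER IN L¹: for every version `T` of (10) along the typed (0.4) averaging,
# `∫ |T1 − 1| dV ≤ 2·dU(guard) ≤ 2·#PBond·Haar{dist1 < δ}^(L^{d−1} − 1)` — the density of `Ū_*(dU)` is L¹-close to `1` exactly as far as the guard is rare

WIDTH SEAT `pub-ymgap-dag-n08-w3` g2, plan `W-SEAT-START-LIST.md` v7 §n08 item 3 PART 9 (the density form of parts 6–7: p594625 `…Guard`, p596156 ∕ p596721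
`…GuardCrossing(Law)`), 2026-08-28.  Track A, DAG node N08 = [Balaban1985UV3] Thm 1 p. 257 (compact) + Thm 2 p. 272; key item K1⁷ `StabilityBAtRecordR13SepCoPH`
(stmt-QuantumFields-20542), `--supports … --as helper`.  COUNT-NEUTRAL.

THE POINT.  N08's slot letter for E6′ is «`T 1 =ᵐ 1`» (dag-n08-a p434996 `B10Eq2HaarCompatibility`: `Ū_*(dU) = (T1)·dV`, so `Ū_*(dU) = dV ⟺ T1 =ᵐ 1`), i.e.
`∫ |T1 − 1| dV = 0`.  Parts 6–7 bound the defect SETWISE (`|∫_A T1 dV − dV(A)| ≤ dU(guard)`); splitting `dV` at the (measurable modification of the) level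
set `{T1 > 1}` turns the two one-sided setwise bounds into the L¹ statement: `∫ |T1 − 1| dV ≤ 2·dU(guard)`, and part 7's product bound makes it explicit.

WHAT THIS FILE PROVES ([folklore] measure theory over the landed parts; nothing of Bałaban's asserted).  §1 (ANY group, ANY measurable small-loop average, standing
range) ★★ `integral_abs_T_one_sub_one_le` (`∫ |T1 − 1| dV ≤ 2·dU(guard)`), `integral_abs_T_one_sub_one_le_card_mul_pow` (`≤ 2·#PBond(j+1)·Haar{dist1 < δ}^(L^{d−1} − 1)`).
§2 at the [B10] slot `avOfPrint N S j` on `SU(N)`, EVERY transformation family `𝔗 : Node00.TFamily₃ N L`, every member and in-range level (`d = 3`):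
`∫ |(𝔗 S j).T 1 − 1| dV ≤ 2·#PBond(j+1)·Haar_{SU(N)}{‖W − 1‖ < min(1∕3, π∕N)}^(L² − 1)` (beyond the range the left side is `0`, p434996).

HONEST FRAMING.  The typed «T1 = 1» letter is NOT decided (part 6's `measure_guard_pos`: the guard is not `dU`-null); this is its L¹ defect, bounded; count-neutral;
N08 NOT discharged; counts unmoved (typed 28∕28 · discharged 5∕27); one finite 𝕋⁴ programme at fixed ε — R4 closes the CONDITIONAL rung `BalabanLadder.UV` only; the
Yang–Mills mass gap (Clay) is NOT proved by any of this; nothing continuum ∕ ℝ³ ∕ ℝ⁴ ∕ OS ∕ mass gap.  0 `sorry`, 0 `def`, 0 `instance`, standard axioms.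
-/

noncomputable section

open MeasureTheory

namespace Summit.QuantumFields.YangMills.BalabanUVNodes.N08HaarCompatibilityGuardDensity

open Literature.MathematicalPhysics.QuantumFieldTheory.Balaban1983to89
open Literature.MathematicalPhysics.QuantumFieldTheory.Balaban1983to89.BlockAveraging (Small avgFun blockAvg blockAvg_avg measurable_avgFun)
open Literature.MathematicalPhysics.QuantumFieldTheory.Balaban1983to89.B10Eq2HaarCompatibility (integrable_T_one setIntegral_T_one)
open Summit.QuantumFields.YangMills.BalabanUVNodes.N08HaarCompatibilityGuard (abs_map_avgFun_real_sub_le avOfPrint_avg_of_le)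
open Summit.QuantumFields.YangMills.BalabanUVNodes.N08HaarCompatibilityGuardCrossingLaw (measure_guard_le_card_mul_pow)

/-! ## §1. The L¹ defect of `T1` from the two one-sided setwise bounds -/

section Generic

variable {P : Params} {j : ℕ} {G : Type*} [GaugeGroup G] [MeasurableSpace G] [RegularGaugeGroup G] [HaarData G] (ℰ : LoopAverage G)

/-- **`∫ |T1 − 1| dV ≤ 2·dU(guard)`** for EVERY version `T` of (10) along ANY averaging whose map is the typed block averaging `avgFun ℰ` (standing range):
split `dV` at the level set `{T1 > 1}` of a measurable modification of `T1` and use part 6's setwise bound `|∫_A T1 dV − dV(A)| ≤ dU(guard)` on it and on its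
complement. [cite: Balaban1985Averaging, (10) p.19; Balaban1987RG1, (0.4) p.253 (bookkeeping; «T1 = 1» NOT IN PRINT, not decided here)] -/
theorem integral_abs_T_one_sub_one_le (hj : j + 1 ≤ P.m + P.K) (hE : ∀ n, Measurable fun W : Fin (n + 1) → G => ℰ.E W)
    {av : Averaging P j G} (hav : av.avg = avgFun ℰ) (T : RTOpI P j G av) :
    ∫ V, |T.T 1 V - 1| ∂(fieldMeasure P (j + 1) G) ≤ 2 * (fieldMeasure P j G).real {U : GaugeField P j G | ∃ c : PBond P (j + 1), Small ℰ U c} := by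
  -- part 6's setwise bound, for this version
  have havg : Measurable av.avg := by rw [hav]; exact measurable_avgFun ℰ hE
  have hset : ∀ {A : Set (GaugeField P (j + 1) G)}, MeasurableSet A →
      |∫ V in A, T.T 1 V ∂(fieldMeasure P (j + 1) G) - (fieldMeasure P (j + 1) G).real A| ≤
        (fieldMeasure P j G).real {U : GaugeField P j G | ∃ c : PBond P (j + 1), Small ℰ U c} := fun {A} hA => by
    rw [setIntegral_T_one T havg hA, ← Measure.map_apply havg hA, hav]
    exact abs_map_avgFun_real_sub_le ℰ hj hE hA
  have hint : Integrable (T.T 1) (fieldMeasure P (j + 1) G) := integrable_T_one T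
  -- a measurable modification `f` of `T1` and its upper level set
  have hfm : Measurable (hint.1.mk (T.T 1)) := hint.1.stronglyMeasurable_mk.measurable
  have hae : T.T 1 =ᵐ[fieldMeasure P (j + 1) G] hint.1.mk (T.T 1) := hint.1.ae_eq_mk
  have hA : MeasurableSet {V : GaugeField P (j + 1) G | 1 < hint.1.mk (T.T 1) V} := measurableSet_lt measurable_const hfm
  have hint1 : Integrable (fun V => T.T 1 V - 1) (fieldMeasure P (j + 1) G) := hint.sub (integrable_const _)
  -- split the L¹ norm at the level set
  have hsplit : ∫ V, |T.T 1 V - 1| ∂(fieldMeasure P (j + 1) G) =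
      ∫ V in {V | 1 < hint.1.mk (T.T 1) V}, (T.T 1 V - 1) ∂(fieldMeasure P (j + 1) G) +
        ∫ V in {V | 1 < hint.1.mk (T.T 1) V}ᶜ, -(T.T 1 V - 1) ∂(fieldMeasure P (j + 1) G) := by
    rw [← integral_add_compl hA hint1.abs]
    congr 1
    · refine setIntegral_congr_ae hA ?_
      filter_upwards [hae] with V hV hVA
      rw [hV]
      exact abs_of_pos (sub_pos.2 hVA)
    · refine setIntegral_congr_ae hA.compl ?_
      filter_upwards [hae] with V hV hVA
      rw [hV]
      exact abs_of_nonpos (by simpa using hVA)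
  have h1 := (abs_le.1 (hset hA)).2
  have h2 := (abs_le.1 (hset hA.compl)).1
  rw [hsplit, integral_neg, integral_sub hint.integrableOn (integrable_const _).integrableOn,
    integral_sub hint.integrableOn (integrable_const _).integrableOn, setIntegral_const, setIntegral_const, smul_eq_mul, mul_one,
    smul_eq_mul, mul_one]
  linarith

/-- For the versions along `blockAvg ℰ` itself. [cite: Balaban1985Averaging, (10) p.19 (bookkeeping)] -/
theorem integral_abs_T_one_sub_one_le_blockAvg (hj : j + 1 ≤ P.m + P.K) (hE : ∀ n, Measurable fun W : Fin (n + 1) → G => ℰ.E W)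
    (T : RTOpI P j G (blockAvg ℰ)) :
    ∫ V, |T.T 1 V - 1| ∂(fieldMeasure P (j + 1) G) ≤ 2 * (fieldMeasure P j G).real {U : GaugeField P j G | ∃ c : PBond P (j + 1), Small ℰ U c} :=
  integral_abs_T_one_sub_one_le ℰ hj hE (blockAvg_avg ℰ) T

/-- **… EXPLICITLY**: `∫ |T1 − 1| dV ≤ 2·#PBond(j+1)·Haar{dist1 < δ}^(L^{d−1} − 1)` (part 7's product bound on the guard).
[cite: Balaban1985Averaging, (10) p.19; Balaban1987RG1, (0.4) p.253 (bookkeeping; «T1 = 1» NOT IN PRINT)] -/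
theorem integral_abs_T_one_sub_one_le_card_mul_pow (hj : j + 1 ≤ P.m + P.K) (hE : ∀ n, Measurable fun W : Fin (n + 1) → G => ℰ.E W)
    {av : Averaging P j G} (hav : av.avg = avgFun ℰ) (T : RTOpI P j G av) :
    ∫ V, |T.T 1 V - 1| ∂(fieldMeasure P (j + 1) G) ≤
      2 * (Fintype.card (PBond P (j + 1)) * (HaarData.haar : Measure G).real {g : G | dist1 g < ℰ.δ} ^ (P.L ^ (P.d - 1) - 1)) := by
  refine (integral_abs_T_one_sub_one_le ℰ hj hE hav T).trans (mul_le_mul_of_nonneg_left ?_ (by norm_num))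
  have h := measure_guard_le_card_mul_pow ℰ hj (G := G)
  have hne : (Fintype.card (PBond P (j + 1)) : ENNReal) * HaarData.haar {g : G | dist1 g < ℰ.δ} ^ (P.L ^ (P.d - 1) - 1) ≠ ⊤ :=
    ENNReal.mul_ne_top (ENNReal.natCast_ne_top _) (ENNReal.pow_ne_top (measure_ne_top _ _))
  have := ENNReal.toReal_mono hne h
  rwa [ENNReal.toReal_mul, ENNReal.toReal_natCast, ENNReal.toReal_pow] at this

end Generic

/-! ## §2. At the [B10] slot's averaging `avOfPrint N S j` on `SU(N)` -/

section Slot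

open Literature.MathematicalPhysics.QuantumFieldTheory.Balaban1985CMP102.Setting (Scales)
open Literature.MathematicalPhysics.QuantumFieldTheory.Balaban1983to89.B10RunsOfRecord (avOfPrint TOfPrint)
open Literature.MathematicalPhysics.QuantumFieldTheory.Balaban1983to89.B10Eq2HaarCompatibility (T_one_ae_eq_one_of_not_le)
open Literature.MathematicalPhysics.QuantumFieldTheory.Balaban1983to89.ExpMeanLog (expMeanLogSU expMeanLogSU_δ measurable_expMeanLogSU_E)
open Literature.MathematicalPhysics.QuantumFieldTheory.Balaban1983to89.Node00 (SU TFamily₃)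

variable (N : ℕ) [NeZero N] {L : ℕ}

variable (L) in
/-- **THE L¹ DEFECT OF «T1 = 1» AT THE SLOT**: for EVERY transformation family `𝔗 : Node00.TFamily₃ N L`, every member and in-range level,
`∫ |(𝔗 S j).T 1 − 1| dV ≤ 2·dU(guard)` (the version `𝔗 S j` is a version of (10) along `avOfPrint N S j`, whose map in the standing range IS the typed block averaging).
[cite: Balaban1985Averaging, (10) p.19; Balaban1985UV3, (2) p.256 (bookkeeping; NOT IN PRINT)] -/
theorem integral_abs_TFamily_one_sub_one_le (𝔗 : TFamily₃ N L) (S : Scales L) {j : ℕ} (hj : j + 1 ≤ S.P.m + S.P.K) :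
    ∫ V, |(𝔗 S j).T 1 V - 1| ∂(fieldMeasure S.P (j + 1) (SU N)) ≤
      2 * (fieldMeasure S.P j (SU N)).real {U : GaugeField S.P j (SU N) | ∃ c : PBond S.P (j + 1), Small (expMeanLogSU : LoopAverage (SU N)) U c} :=
  integral_abs_T_one_sub_one_le _ hj measurable_expMeanLogSU_E (avOfPrint_avg_of_le N S hj) (𝔗 S j)

variable (L) in
/-- **… EXPLICITLY** (`d = 3`): `∫ |(𝔗 S j).T 1 − 1| dV ≤ 2·#PBond(j+1)·Haar_{SU(N)}{‖W − 1‖ < min(1∕3, π∕N)}^(L² − 1)` (beyond the range the left side is `0`, p434996).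
[cite: Balaban1985Averaging, (10) p.19; Balaban1985UV3, (2) p.256 (bookkeeping; NOT IN PRINT)] -/
theorem integral_abs_TFamily_one_sub_one_le_card_mul_pow (𝔗 : TFamily₃ N L) (S : Scales L) {j : ℕ} (hj : j + 1 ≤ S.P.m + S.P.K) :
    ∫ V, |(𝔗 S j).T 1 V - 1| ∂(fieldMeasure S.P (j + 1) (SU N)) ≤
      2 * (Fintype.card (PBond S.P (j + 1)) * (HaarData.haar : Measure (SU N)).real {g : SU N | dist1 g < min (1 / 3) (Real.pi / N)} ^ (L ^ 2 - 1)) := by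
  have h := integral_abs_T_one_sub_one_le_card_mul_pow _ hj measurable_expMeanLogSU_E (avOfPrint_avg_of_le N S hj) (𝔗 S j)
  rwa [expMeanLogSU_δ, Fintype.card_fin] at h

variable (L) in
/-- Beyond the standing range every version fixes `1` a.e. (p434996), so there the L¹ defect vanishes. [cite: Balaban1985UV3, (2) p.256 (bookkeeping)] -/
theorem integral_abs_TFamily_one_sub_one_eq_zero_of_not_le (𝔗 : TFamily₃ N L) (S : Scales L) {j : ℕ} (hj : ¬ j + 1 ≤ S.P.m + S.P.K) :
    ∫ V, |(𝔗 S j).T 1 V - 1| ∂(fieldMeasure S.P (j + 1) (SU N)) = 0 := by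
  refine integral_eq_zero_of_ae ?_
  filter_upwards [T_one_ae_eq_one_of_not_le N S j 𝔗 hj] with V hV
  simp [hV]

end Slot

end Summit.QuantumFields.YangMills.BalabanUVNodes.N08HaarCompatibilityGuardDensity

end
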